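import Summits.ABC.ABC.Theorems.TwistAmplificationMazurKaneLawSqrtLatticeDefs

/-!
# Crux `TwistAmplification.MazurKaneLaw` (stmt-ABC-2757), line `fibre-toolkit-lp-wall-map`: vocabulary of the certified
# RECORD EXPONENTS (the interface between a linear-programme certificate and the endgame)

The enlarged fibre toolkit of skeleton v3 (trivial, subset geometry of numbers, Fourier, determinant, square-root lattice;
all landed) does not reach the Mazur–Kane law `s − 1`, but its exact linear programme (lead c1, `lp/` of the proving session;
value `V⁺(s)`) lies strictly below the 2026 records `min(1, (23s+3)/40)` (Bernert–Browning–Lichtman–Teräväinen v2 Thm 1.2 / Kane)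
on all of `(1, 16/9)`, and below `13/20` (resp. `3/5`) at `s = 1`. A record exponent `Vc` at `s₀` is certified in three steps:

1. a PURE-REAL LP LEMMA `lp_<tag>` (generated cover tree, `linarith` leaves): the structural inequalities of the exponent data
   with a slack `σ ∈ [0, 1/1000]` and one dictionary inequality per tool used imply `D ≤ Vc + σ`;
2. an INSTANCE `RecordInstance J s₀ Vc` (this file states it): for shape data in dimension `J + e` carrying the standing
   hypotheses of the exponent dictionary (`AbcShapes.trivial_linear` / `geometry_disjunction` / `fourier_linear`,
   `det_linear`, `sqrtLattice_linear`), the determinant tool beyond `P₀` and the two square-root lattice tools,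
   `log_Λ B ≤ Vc + σ` with the explicit slack `σ = recordSlack J (J+e) Λ Dτ P₀ t s₀` whenever `σ ≤ 1/1000`;
3. the ENDGAME and TRANSFER (generic in `(J, s₀, Vc)`, file `…RecordEndgame.lean`): `RecordInstance J s₀ Vc` gives
   `B_M ≤ K C₀^{Vc+η}` on data admissible for `(l, ε′)` with `l + 3ε′ ≤ s₀` (`M = J + e`), hence
   `#{abc triples, c ≤ N, rad(abc) ≤ c^s} ≤ C N^{Vc+ε}` for every `s < s₀` (and `N_l(X) ≪ X^{Vc+ε}` for `l < s₀`).

Targets (lead c1, 2026-08-16): `RecordInstance 3 (7/4) (49/50)` (first power saving below Kane's `N^{1+ε}` on `(37/23, 7/4)`),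
`RecordInstance 4 (3/2) (7/8)`, `RecordInstance 4 1 (31/50)` (abc hits `≪ X^{0.62+ε}`, below `13/20`), then `(5, 1, 3/5)`.
Nothing is proved here.
-/

noncomputable section

-- `Summit.<Summit>.<Problem>` is the mandated summit-side namespace; the duplicate `ABC.ABC` is deliberate (single-conjunct summit).
set_option linter.dupNamespace false

open Finset
open Literature.NumberTheory.DiophantineGeometry
open Literature.NumberTheory.DiophantineGeometry.AbcShapes

namespace Summit.ABC.ABC.Theorems.MazurKaneLaw.Toolkit

/-- The SLACK of a record instance in dimension `d = J + e` at scale `Λ`: it dominates every loss term of the five dictionary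
entries (`d·logΛ Dτ` trivial; `3d·logΛ Dτ + (8 + Σ_I(i+1) + Σ_J(i+1))·logΛ 2 + logΛ V₂` geometry, with `Σ_I (i+1) ≤ J(J+1)/2`
for index sets inside the first `J` coordinates; `logΛ 27 + (12d+3)·logΛ Dτ` Fourier; `(3i+6)·logΛ Dτ + logΛ(24(i+1)(i+2)) +
logΛ P₀ + logΛ 48` determinant at `i < J`; `(d+i+2)·logΛ Dτ + logΛ 114` square-root lattice), the deficit `logΛ 2 + logΛ V₂`
of `log_Λ(c₃·shapeVal Z)` below `1`, and the excess `(t − s₀)₊` of the radical exponent over the LP's `s₀`. -/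
def recordSlack (J d : ℕ) (Λ : ℝ) (Dτ : ℕ) (P₀ t s₀ : ℝ) : ℝ :=
  (12 * (d : ℝ) + 3 * J + 10) * Real.logb Λ Dτ + ((J : ℝ) ^ 2 + J + 10) * Real.logb Λ 2 +
    Real.logb Λ ((shapeVal (fun _ : Fin d => 2) : ℕ) : ℝ) + Real.logb Λ 27 + Real.logb Λ 48 + Real.logb Λ 114 +
    Real.logb Λ (24 * (J : ℝ) * ((J : ℝ) + 1)) + Real.logb Λ P₀ + max (t - s₀) 0

/-- THE RECORD-INSTANCE FACT for `(J, s₀, Vc)`: in every dimension `J + e`, for shape data with the standing hypotheses of the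
exponent dictionary (positivity, `cⱼ · shapeVal(2·) ≤ T`, `τ(m) ≤ Dτ` below `T`), at dyadic level `C₀ ≥ 1`
(`C₀ ≤ V₂ c₃ shapeVal Z`, `cⱼ shapeVal ≤ 2C₀`), radical exponent `t` (`∏ XᵢYᵢZᵢ ≤ (2C₀)^t`), `B > 0`, the determinant tool
at every coordinate `i ≥ 1` beyond `P₀ ≥ 1`, and the two square-root lattice tools, the log-count satisfies
`log_{2C₀} B ≤ Vc + σ` for `σ = recordSlack J (J+e) (2C₀) Dτ P₀ t s₀` whenever `σ ≤ 1/1000`. Proved per target from the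
generated LP lemma `lp_<tag>` by instantiating the dictionary (pattern `AbcShapes.logb_shapeCount_le`). -/
def RecordInstance (J : ℕ) (s₀ Vc : ℝ) : Prop :=
  ∀ {e : ℕ} {c₁ c₂ c₃ C₀ : ℕ}, 0 < c₁ → 0 < c₂ → 0 < c₃ → 1 ≤ C₀ →
  ∀ {X Y Z : Fin (J + e) → ℕ}, (∀ i, 0 < X i) → (∀ i, 0 < Y i) → (∀ i, 0 < Z i) →
  ∀ {T Dτ : ℕ}, c₁ * shapeVal (fun i => 2 * X i) ≤ T → c₂ * shapeVal (fun i => 2 * Y i) ≤ T →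
    c₃ * shapeVal (fun i => 2 * Z i) ≤ T → (∀ m : ℕ, m ≠ 0 → m ≤ T → m.divisors.card ≤ Dτ) →
  C₀ ≤ shapeVal (fun _ : Fin (J + e) => 2) * (c₃ * shapeVal Z) →
  c₁ * shapeVal X ≤ 2 * C₀ → c₂ * shapeVal Y ≤ 2 * C₀ → c₃ * shapeVal Z ≤ 2 * C₀ →
  ∀ {t : ℝ}, (∏ i, ((X i : ℝ) * Y i * Z i)) ≤ (2 * C₀ : ℝ) ^ t →
  0 < shapeCount c₁ c₂ c₃ X Y Z →
  ∀ {P₀ : ℝ}, 1 ≤ P₀ →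
  (∀ i : Fin (J + e), 1 ≤ (i : ℕ) → ∀ P : ℝ, P₀ ≤ P →
    48 * ((X i : ℝ) * Y i * Z i) ≤
      ((c₁ * offVal ({i} : Finset (Fin (J + e))) X : ℕ) : ℝ) * ((c₂ * offVal ({i} : Finset (Fin (J + e))) Y : ℕ) : ℝ) *
        ((c₃ * offVal ({i} : Finset (Fin (J + e))) Z : ℕ) : ℝ) * P ^ 3 →
    (shapeCount c₁ c₂ c₃ X Y Z : ℝ) ≤
      ((subBox ({i} : Finset (Fin (J + e))) X).card * (subBox ({i} : Finset (Fin (J + e))) Y).card *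
          (subBox ({i} : Finset (Fin (J + e))) Z).card : ℕ) *
        (Dτ : ℝ) ^ (3 * ((i : ℕ) + 2)) * (24 * ((((i : ℕ) : ℝ) + 1) * (((i : ℕ) : ℝ) + 2))) * P) →
  SqrtLatticeToolX → SqrtLatticeToolZ →
  recordSlack J (J + e) (2 * C₀) Dτ P₀ t s₀ ≤ 1 / 1000 →
    Real.logb (2 * C₀) (shapeCount c₁ c₂ c₃ X Y Z) ≤ Vc + recordSlack J (J + e) (2 * C₀) Dτ P₀ t s₀

/-- THE CERTIFIED RECORD at `(s₀, Vc)` in the crux's own terms: for every `s < s₀` and `ε > 0`,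
`#{abc triples (a,b,c) : c ≤ N, rad(abc) ≤ c^s} ≤ C · N^{Vc+ε}` for `N ≥ 2` (the Mazur–Kane count at `s` with the law's
`s − 1` replaced by `Vc`). The endgame proves `RecordInstance J s₀ Vc → RecordAt s₀ Vc` for `3 ≤ J`. -/
def RecordAt (s₀ Vc : ℝ) : Prop :=
  ∀ s : ℝ, s < s₀ → ∀ ε : ℝ, 0 < ε → ∃ C : ℝ, ∀ N : ℕ, 2 ≤ N →
    (Set.ncard {t : ℕ × ℕ × ℕ | Literature.NumberTheory.DiophantineGeometry.IsABCTriple t.1 t.2.1 t.2.2 ∧ t.2.2 ≤ N ∧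
      ((Literature.NumberTheory.DiophantineGeometry.rad t.1 t.2.1 t.2.2 : ℕ) : ℝ) ≤ (t.2.2 : ℝ) ^ s} : ℝ) ≤ C * (N : ℝ) ^ (Vc + ε)

/-- Sanity/registration lemma (registered sub-goal `recordAt_mono` of crux stmt-ABC-2757, stated verbatim): a record at a
larger exponent window is a record at every smaller one. -/
theorem recordAt_mono : ∀ (s₀ s₁ Vc : ℝ), s₁ ≤ s₀ → Summit.ABC.ABC.Theorems.MazurKaneLaw.Toolkit.RecordAt s₀ Vc → Summit.ABC.ABC.Theorems.MazurKaneLaw.Toolkit.RecordAt s₁ Vc :=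
  fun _ _ _ h01 h s hs => h s (lt_of_lt_of_le hs h01)

end Summit.ABC.ABC.Theorems.MazurKaneLaw.Toolkit

end
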